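import Literature.Geometry.Riemannian.HeatKernelGaussianIntegralBoundHCenter
import Literature.Geometry.Riemannian.RicciFlowHConcentrationHolds
import Literature.Geometry.Riemannian.MetricFlowHCenters
import Literature.Geometry.Riemannian.RicciFlowHeatKernelFn
import Literature.Geometry.Riemannian.HeatKernelJointGradientContinuityAux
import Literature.Geometry.Riemannian.NashEntropy
import Literature.Geometry.Riemannian.HeatKernelBootstrapGradient
import Literature.Geometry.Riemannian.HeatKernelBootstrapTail
import Literature.Geometry.Riemannian.HeatKernelBootstrapBall
import HarnessLib
import Literature.Geometry.Riemannian.KernelNashEntropyW1Bound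

/-!
# The one-step recursion behind Bamler's heat kernel upper bound (Bamler 2020a, Thm. 7.1)

R. Bamler, *Entropy and heat kernel bounds on a Ricci flow background*, arXiv:2008.07093 (2020a),
§7.2, proof of Thm. 7.1 (arXiv v1 Thm. 24). With `u(·,r) = K(·,r;y,s)` and
`F(x,τ) = τ^{m/2} e^{𝒩*_s(x,s+τ)} u(x,s+τ)`, the printed induction step ("if (7.2) holds for
some `Z`, then it also holds with `Z/2` if `Z ≥ Z̲`"), run at a fixed scale `τ` with the radius
parameter `A` of the ball `B(z₁,t₁,√(A H_m)ρ√τ)` kept free (Bamler: `A = 100`), is the two-point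
recursion `F(x,τ) ≤ E₁(ρ) + θ₂(ρ,A) sup F(·,τ/2) + θ₁(ρ,A) sup F(·,(1−ρ²)τ)` with coefficients
depending only on `m`, `Λ ≥ −R_min τ`, `ρ`, `A` (`IsRicciFlow.heatKernelFn_bootstrap_step`). It is
assembled from the gradient step (7.6)–(7.8) (`gradSq_heatKernelFn_le_of_forall_le`), the ball
part (7.10)–(7.12) (`heatKernelFn_le_on_ball_of_forall_gradSq_le`), the tail part (7.13)
(`setIntegral_heatKernelFn_compl_ball_le`), the entropy comparison near an `H_m`-centre
(`kernelNashEntropy_sub_le_of_lintegral_edist_sq_le`), the existence of `H_m`-centres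
(`IsRicciFlow.exists_lintegral_edist_sq_heatKernelMeasure_le`) and the reproduction formula.
The iteration over dyadic scales is `HeatKernelUpperBound.lean`.

## References

* R. H. Bamler, *Entropy and heat kernel bounds on a Ricci flow background*, arXiv:2008.07093
  (2020), §7.2, proof of Thm. 7.1. [Bamler2020Entropy]
-/


noncomputable section

open Set Filter Function MeasureTheory Measure
open scoped Manifold ContDiff Topology ENNReal NNReal

namespace Literature.Geometry.Riemannian

open Lorentzian Lorentzian.PseudoRiemannianMetric

section Step

variable {m : ℕ} {M : Type*} [TopologicalSpace M] [ChartedSpace (EuclideanSpace ℝ (Fin m)) M]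
  [IsManifold 𝓘(ℝ, EuclideanSpace ℝ (Fin m)) ∞ M] [T2Space M] [CompactSpace M]
  [SecondCountableTopology M] [MeasurableSpace M] [BorelSpace M] [ConnectedSpace M]
  {h : ℝ → PseudoRiemannianMetric 𝓘(ℝ, EuclideanSpace ℝ (Fin m)) ∞ (EuclideanSpace ℝ (Fin m))
    (TangentSpace 𝓘(ℝ, EuclideanSpace ℝ (Fin m)) : M → Type _)}
  {cov : ℝ → CovariantDerivative 𝓘(ℝ, EuclideanSpace ℝ (Fin m)) (EuclideanSpace ℝ (Fin m))
    (TangentSpace 𝓘(ℝ, EuclideanSpace ℝ (Fin m)) : M → Type _)}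
  {a T : ℝ} (hh : IsContMDiffFamilyOn ∞ h univ) (hR : ∀ r, (h r).IsRiemannian)

/-- **The one-step recursion of Bamler's bootstrap** (2020a, §7.2, proof of Thm. 7.1, at a fixed
scale). For a Ricci flow on `[a, T]` of a `C^∞` family of Riemannian metrics on a closed connected
manifold modelled on `ℝᵐ` (`m ≥ 3`), `a < s`, `0 < τ`, `s + τ < T`, `R ≥ R_min` on
`M × [s, s+τ]`, `−R_min τ ≤ Λ`, `0 < ρ ≤ 1/2`, `A ≥ 2`, a pole `(y, s)` of `u(·,r) = K(·,r;y,s)`,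
and the inductive bounds `u(·,t₁) ≤ Z₁((1−ρ²)τ)^{-m/2}e^{−𝒩*_s(·,t₁)}` (`t₁ = s+(1−ρ²)τ`),
`u(·,s+τ/2) ≤ Z₂(τ/2)^{-m/2}e^{−𝒩*_s(·,s+τ/2)}`: at every `x`,
`τ^{m/2} e^{𝒩*_s(x,s+τ)} u(x,s+τ) ≤ E₁ + θ₂ Z₂ + θ₁ Z₁` with the explicit coefficients of the
statement (`E₁`: ball average via the mass bound (7.3) and Thm. 6.2; `θ₂`: oscillation over the
ball via the gradient step; `θ₁`: tail via Cauchy–Schwarz, Chebyshev at the `H_m`-centre and the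
exponential moment bound; `H = H_m = (m−1)π²/2 + 4`).
[cite: Bamler2020Entropy, §7.2, proof of Thm. 7.1] -/
theorem IsRicciFlow.heatKernelFn_bootstrap_step (hflow : IsRicciFlow h cov (Icc a T)) (hm : 3 ≤ m)
    {s τ ρ A : ℝ} (has : a < s) (hτ : 0 < τ) (hτT : s + τ < T) (hρ : 0 < ρ) (hρ2 : ρ ≤ 1 / 2)
    (hA : 2 ≤ A) {Rmin Λ : ℝ}
    (hRmin : ∀ r ∈ Icc s (s + τ), ∀ z : M, Rmin ≤ (h r).scalarCurvatureWith (cov r) z)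
    (hΛ : 0 ≤ Λ) (hRΛ : -Rmin * τ ≤ Λ) (y : M) {Z₁ Z₂ : ℝ} (hZ₁ : 0 ≤ Z₁) (hZ₂ : 0 ≤ Z₂)
    (HZ₁ : ∀ w : M, hflow.heatKernelFn hh hR (s + (1 - ρ ^ 2) * τ) w (y, s) ≤
      Z₁ * ((1 - ρ ^ 2) * τ) ^ (-(m : ℝ) / 2) * Real.exp (-(pointedNashEntropy h
        (fun r v ↦ hflow.heatKernelFn hh hR (s + (1 - ρ ^ 2) * τ) w (v, r)) m
        (s + (1 - ρ ^ 2) * τ) s)))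
    (HZ₂ : ∀ z : M, hflow.heatKernelFn hh hR (s + τ / 2) z (y, s) ≤
      Z₂ * (τ / 2) ^ (-(m : ℝ) / 2) * Real.exp (-(pointedNashEntropy h
        (fun r w ↦ hflow.heatKernelFn hh hR (s + τ / 2) z (w, r)) m (s + τ / 2) s)))
    (x : M) :
    τ ^ ((m : ℝ) / 2) * Real.exp (pointedNashEntropy h
        (fun r v ↦ hflow.heatKernelFn hh hR (s + τ) x (v, r)) m (s + τ) s) *
      hflow.heatKernelFn hh hR (s + τ) x (y, s) ≤
    2 * Real.exp Λ * (4 * Real.pi) ^ (-(m : ℝ) / 2) * Real.exp (-(m : ℝ) / 2) *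
          Real.exp (2 * Real.sqrt ((m : ℝ) + Λ)) * ρ ^ (-(m : ℝ)) +
      2 * Real.sqrt (A * (((m : ℝ) - 1) * Real.pi ^ 2 / 2 + 4)) *
          Real.exp ((Real.sqrt ((m : ℝ) + Λ) * Real.sqrt (((m : ℝ) - 1) * Real.pi ^ 2 / 2 + 4) +
            3 * Real.sqrt ((m : ℝ) + Λ) *
              Real.sqrt (A * (((m : ℝ) - 1) * Real.pi ^ 2 / 2 + 4))) * ρ) *
          Real.sqrt (2 ^ (m + 2) * 3 * Real.exp (4 * Real.sqrt ((m : ℝ) + Λ) *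
            Real.sqrt (((m : ℝ) - 1) * Real.pi ^ 2 / 2 + 4) + 16 * ((m : ℝ) + Λ))) * ρ * Z₂ +
      (1 - ρ ^ 2) ^ (-(m : ℝ) / 2) *
          Real.exp (Real.sqrt ((m : ℝ) + Λ) * ρ *
            Real.sqrt (((m : ℝ) - 1) * Real.pi ^ 2 / 2 + 4)) *
          Real.sqrt (3 / A) *
          Real.exp (16 * (((m : ℝ) + Λ) * ρ ^ 2) +
            Real.sqrt (2 * (((m : ℝ) - 1) * Real.pi ^ 2 / 2 + 4)) * (Real.sqrt ((m : ℝ) + Λ) * ρ)) *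
          Z₁ := by
  have hm0 : 0 < m := by omega
  set Hm : ℝ := ((m : ℝ) - 1) * Real.pi ^ 2 / 2 + 4 with hHm
  have hm1 : (1 : ℝ) ≤ m := by exact_mod_cast hm0
  have hHm4 : 4 ≤ Hm := by
    have : 0 ≤ ((m : ℝ) - 1) * Real.pi ^ 2 / 2 := by
      have := Real.pi_pos; positivity
    linarith
  have hHm0 : 0 < Hm := by linarith
  have hρsq : ρ ^ 2 ≤ 1 / 4 := by
    have := pow_le_pow_left₀ hρ.le hρ2 2; norm_num at this; exact this
  have hρsq0 : 0 < ρ ^ 2 := by positivity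
  have h1ρ : 3 / 4 ≤ 1 - ρ ^ 2 := by linarith
  have h1ρ0 : 0 < 1 - ρ ^ 2 := by linarith
  have h1ρ1 : 1 - ρ ^ 2 ≤ 1 := by linarith
  set t : ℝ := s + τ with ht
  set t₁ : ℝ := s + (1 - ρ ^ 2) * τ with ht₁
  have hst₁ : s < t₁ := by rw [ht₁]; linarith [mul_pos h1ρ0 hτ]
  have ht₁t : t₁ < t := by
    have : (1 - ρ ^ 2) * τ = τ - ρ ^ 2 * τ := by ring
    rw [ht₁, ht, this]; linarith [mul_pos hρsq0 hτ]
  have htt₁ : t - t₁ = ρ ^ 2 * τ := by rw [ht₁, ht]; ring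
  have ht₁s : t₁ - s = (1 - ρ ^ 2) * τ := by rw [ht₁]; ring
  have htT : t < T := hτT
  have hat₁ : a < t₁ := has.trans hst₁
  have ht₁T : t₁ ∈ Icc a T := ⟨hat₁.le, (ht₁t.trans htT).le⟩
  have htI : t ∈ Icc a T := ⟨(hat₁.trans ht₁t).le, htT.le⟩
  have hmΛ : 0 ≤ (m : ℝ) + Λ := by positivity
  have hRmτ : -Rmin ≤ Λ / τ := by rw [le_div_iff₀ hτ]; linarith
  have hRs : ∀ z : M, Rmin ≤ (h s).scalarCurvatureWith (cov s) z :=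
    hRmin s ⟨le_rfl, by linarith⟩
  obtain ⟨z₁, hvar₁⟩ :=
    hflow.exists_lintegral_edist_sq_heatKernelMeasure_le hh hR hm0 ht₁T htI ht₁t.le x
  set L₁ : ℝ := Real.sqrt ((m : ℝ) / (2 * (t₁ - s)) - Rmin) with hL₁
  have hL₁0 : 0 ≤ L₁ := Real.sqrt_nonneg _
  set V : ℝ := Hm * (t - t₁) with hV
  have hV0 : 0 ≤ V := by rw [hV, htt₁]; positivity
  set c₁ : ℝ := L₁ * Real.sqrt V with hc₁
  have hc₁0 : 0 ≤ c₁ := by positivity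
  have hEC₁ : ∀ w : M, pointedNashEntropy h (fun r v ↦ hflow.heatKernelFn hh hR t x (v, r)) m t s -
      pointedNashEntropy h (fun r v ↦ hflow.heatKernelFn hh hR t₁ w (v, r)) m t₁ s ≤
      c₁ + L₁ * ((h t₁).edist (hR t₁) z₁ w).toReal := by
    intro w
    have := kernelNashEntropy_sub_le_of_lintegral_edist_sq_le hflow hh hR hm has hst₁ ht₁t.le htT
      hRs x z₁ hV0 hvar₁ w
    rw [hc₁]; linarith [this]
  have hL₁τ : L₁ * Real.sqrt τ ≤ Real.sqrt ((m : ℝ) + Λ) := by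
    refine sqrt_mul_sqrt_le_sqrt_of_le_div hτ ?_
    have h2 : (m : ℝ) / (2 * (t₁ - s)) ≤ (m : ℝ) / τ := by
      rw [ht₁s]
      refine div_le_div_of_nonneg_left (by positivity) hτ ?_
      have := mul_le_mul_of_nonneg_right h1ρ hτ.le
      linarith
    rw [add_div]; linarith
  set s₂ : ℝ := s + τ / 2 with hs₂
  have hss₂ : s < s₂ := by rw [hs₂]; linarith
  set L' : ℝ := Real.sqrt ((m : ℝ) / (2 * (s₂ - s)) - Rmin) with hL'
  have hL'0 : 0 ≤ L' := Real.sqrt_nonneg _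
  set c' : ℝ := L' * Real.sqrt (Hm * (τ / 2)) with hc'
  have hc'0 : 0 ≤ c' := by positivity
  -- entropy comparison at every `(x', t')`, `t' ∈ [s + 3τ/4, s + τ]`, against time `s₂`
  have hEC' : ∀ x' : M, ∀ t' ∈ Icc (s + 3 * τ / 4) (s + τ), ∃ z : M,
      ∫⁻ w, (h s₂).edist (hR s₂) z w ^ 2 ∂(heatKernelMeasure hh hR t' x' s₂) ≤
        ENNReal.ofReal (Hm * (t' - s₂)) ∧
      ∀ w : M, pointedNashEntropy h (fun r v ↦ hflow.heatKernelFn hh hR t' x' (v, r)) m t' s -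
          pointedNashEntropy h (fun r v ↦ hflow.heatKernelFn hh hR s₂ w (v, r)) m s₂ s ≤
        c' + L' * ((h s₂).edist (hR s₂) z w).toReal := by
    intro x' t' ht'
    have hs₂t' : s₂ ≤ t' := by rw [hs₂]; linarith [ht'.1]
    have ht'T : t' < T := lt_of_le_of_lt ht'.2 hτT
    have hs₂I : s₂ ∈ Icc a T := ⟨(has.trans hss₂).le, hs₂t'.trans ht'T.le⟩
    have ht'I : t' ∈ Icc a T := ⟨((has.trans hss₂).trans_le hs₂t').le, ht'T.le⟩
    obtain ⟨z, hz⟩ :=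
      hflow.exists_lintegral_edist_sq_heatKernelMeasure_le hh hR hm0 hs₂I ht'I hs₂t' x'
    refine ⟨z, hz, fun w ↦ ?_⟩
    have hV'0 : 0 ≤ Hm * (t' - s₂) := mul_nonneg hHm0.le (sub_nonneg.2 hs₂t')
    have hmain := kernelNashEntropy_sub_le_of_lintegral_edist_sq_le hflow hh hR hm has hss₂ hs₂t'
      ht'T hRs x' z hV'0 hz w
    have hsqrt : Real.sqrt (Hm * (t' - s₂)) ≤ Real.sqrt (Hm * (τ / 2)) := by
      refine Real.sqrt_le_sqrt ?_
      have : t' - s₂ ≤ τ / 2 := by rw [hs₂]; linarith [ht'.2]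
      exact mul_le_mul_of_nonneg_left this hHm0.le
    calc _ ≤ L' * (Real.sqrt (Hm * (t' - s₂)) + ((h s₂).edist (hR s₂) z w).toReal) := hmain
      _ ≤ L' * (Real.sqrt (Hm * (τ / 2)) + ((h s₂).edist (hR s₂) z w).toReal) := by gcongr
      _ = c' + L' * ((h s₂).edist (hR s₂) z w).toReal := by rw [hc']; ring
  have hG' :=
    gradSq_heatKernelFn_le_of_forall_le hflow hh hR hm0 has hτ hτT y hZ₂ hL'0 hc'0 HZ₂ hEC'
  -- `L' √τ ≤ √(m + Λ)` and the scale-free bound of the gradient-step constant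
  have hL'τ : L' * Real.sqrt τ ≤ Real.sqrt ((m : ℝ) + Λ) := by
    refine sqrt_mul_sqrt_le_sqrt_of_le_div hτ ?_
    have h2 : (m : ℝ) / (2 * (s₂ - s)) = (m : ℝ) / τ := by rw [hs₂]; ring_nf
    rw [h2, add_div]; linarith
  have hsqτ : Real.sqrt τ ^ 2 = τ := Real.sq_sqrt hτ.le
  have hL'sqτ : L' ^ 2 * τ ≤ (m : ℝ) + Λ := by
    have h1 : L' ^ 2 * τ = (L' * Real.sqrt τ) ^ 2 := by rw [mul_pow, hsqτ]
    rw [h1, ← Real.sq_sqrt hmΛ]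
    exact pow_le_pow_left₀ (by positivity) hL'τ 2
  have hexpG : 2 * c' + 16 * L' ^ 2 * τ + 2 * L' * Real.sqrt (Hm * τ) ≤
      4 * Real.sqrt ((m : ℝ) + Λ) * Real.sqrt Hm + 16 * ((m : ℝ) + Λ) := by
    -- `c' ≤ L' √τ √H ≤ √(m+Λ) √H` and `L' √(Hτ) = L' √τ √H ≤ √(m+Λ) √H`
    have hsq1 : Real.sqrt (Hm * (τ / 2)) ≤ Real.sqrt τ * Real.sqrt Hm := by
      rw [← Real.sqrt_mul hτ.le]
      refine Real.sqrt_le_sqrt ?_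
      have := mul_pos hτ hHm0
      linarith
    have hsq2 : Real.sqrt (Hm * τ) = Real.sqrt τ * Real.sqrt Hm := by
      rw [← Real.sqrt_mul hτ.le, mul_comm]
    have hc'le : c' ≤ Real.sqrt ((m : ℝ) + Λ) * Real.sqrt Hm := by
      have h1 : c' ≤ L' * (Real.sqrt τ * Real.sqrt Hm) := by
        rw [hc']; exact mul_le_mul_of_nonneg_left hsq1 hL'0
      have h2 : L' * (Real.sqrt τ * Real.sqrt Hm) = (L' * Real.sqrt τ) * Real.sqrt Hm := by ring
      have h3 : (L' * Real.sqrt τ) * Real.sqrt Hm ≤ Real.sqrt ((m : ℝ) + Λ) * Real.sqrt Hm :=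
        mul_le_mul_of_nonneg_right hL'τ (Real.sqrt_nonneg _)
      linarith
    have hLH : L' * Real.sqrt (Hm * τ) ≤ Real.sqrt ((m : ℝ) + Λ) * Real.sqrt Hm := by
      rw [hsq2, ← mul_assoc]
      exact mul_le_mul_of_nonneg_right hL'τ (Real.sqrt_nonneg _)
    have h16 : 16 * L' ^ 2 * τ = 16 * (L' ^ 2 * τ) := by ring
    rw [h16]
    linarith [hc'le, hLH, hL'sqτ]
  set Cgs : ℝ := Real.sqrt (2 ^ (m + 2) * 3 *
    Real.exp (4 * Real.sqrt ((m : ℝ) + Λ) * Real.sqrt Hm + 16 * ((m : ℝ) + Λ))) with hCgs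
  have hCgs0 : 0 ≤ Cgs := Real.sqrt_nonneg _
  have hCgsq : 2 ^ (m + 2) * 3 * Real.exp (2 * c' + 16 * L' ^ 2 * τ +
      2 * L' * Real.sqrt (Hm * τ)) ≤ Cgs ^ 2 := by
    rw [hCgs, Real.sq_sqrt (by positivity : (0 : ℝ) ≤ 2 ^ (m + 2) * 3 *
      Real.exp (4 * Real.sqrt ((m : ℝ) + Λ) * Real.sqrt Hm + 16 * ((m : ℝ) + Λ)))]
    gcongr
  -- the gradient bound at time `t₁` (a member of `[s + 3τ/4, s + τ]`)
  have ht₁mem : t₁ ∈ Icc (s + 3 * τ / 4) (s + τ) := by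
    have h1 := mul_le_mul_of_nonneg_right h1ρ hτ.le
    have h2 := mul_le_of_le_one_left hτ.le h1ρ1
    rw [ht₁]; constructor <;> linarith
  have hgrad : ∀ w : M, (h t₁).gradSq (fun v ↦ hflow.heatKernelFn hh hR t₁ v (y, s)) w ≤
      Cgs ^ 2 * Z₂ ^ 2 * τ ^ (-((m : ℝ) + 1)) * Real.exp (-2 * pointedNashEntropy h
        (fun r v ↦ hflow.heatKernelFn hh hR t₁ w (v, r)) m t₁ s) := by
    intro w
    have := hG' w t₁ ht₁mem
    refine this.trans ?_
    have h0 : 0 ≤ Z₂ ^ 2 * τ ^ (-((m : ℝ) + 1)) * Real.exp (-2 * pointedNashEntropy h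
        (fun r v ↦ hflow.heatKernelFn hh hR t₁ w (v, r)) m t₁ s) := by positivity
    calc _ = (2 ^ (m + 2) * 3 * Real.exp (2 * c' + 16 * L' ^ 2 * τ +
          2 * L' * Real.sqrt (Hm * τ))) * (Z₂ ^ 2 * τ ^ (-((m : ℝ) + 1)) *
          Real.exp (-2 * pointedNashEntropy h
            (fun r v ↦ hflow.heatKernelFn hh hR t₁ w (v, r)) m t₁ s)) := by ring
      _ ≤ Cgs ^ 2 * (Z₂ ^ 2 * τ ^ (-((m : ℝ) + 1)) * Real.exp (-2 * pointedNashEntropy h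
            (fun r v ↦ hflow.heatKernelFn hh hR t₁ w (v, r)) m t₁ s)) :=
          mul_le_mul_of_nonneg_right hCgsq h0
      _ = _ := by ring
  have hBall := heatKernelFn_le_on_ball_of_forall_gradSq_le hflow hh hR hm has hτ hτT.le hρ hρ2
    hRmin hΛ hRΛ y x z₁ hA hZ₂ hCgs0 hL₁0 hc₁0 hvar₁ hEC₁ hgrad
  have hTail := setIntegral_heatKernelFn_compl_ball_le hflow hh hR hm0 has hτ hτT.le hρ hρ2 y x z₁
    hA hZ₁ hL₁0 hc₁0 hvar₁ HZ₁ hEC₁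
  set ν : Measure M := heatKernelMeasure hh hR t x t₁ with hν
  set r₀ : ℝ := Real.sqrt (A * Hm) * ρ * Real.sqrt τ with hr₀
  set S : Set M := {w | ENNReal.ofReal r₀ ≤ (h t₁).edist (hR t₁) z₁ w} with hS
  set f : M → ℝ := fun w ↦ hflow.heatKernelFn hh hR t₁ w (y, s) with hf
  have hrep : hflow.heatKernelFn hh hR t x (y, s) = ∫ w, f w ∂ν :=
    hflow.heatKernelFn_reproduction hh hR hat₁ ht₁t htT.le x ⟨has, hst₁⟩ y
  have hdm : Measurable fun w ↦ (h t₁).edist (hR t₁) z₁ w :=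
    ((PseudoRiemannianMetric.continuous_edist (hR t₁)).comp
      (continuous_const.prodMk continuous_id)).measurable
  have hSm : MeasurableSet S := measurableSet_le measurable_const hdm
  have hfc : Continuous f :=
    hflow.continuous_heatKernelFn_basePoint_slice hh hR ⟨hat₁, (ht₁t.trans htT).le⟩ ⟨has, hst₁⟩
  have hfi : Integrable f ν :=
    (hfc.continuousOn.integrableOn_compact isCompact_univ).integrable_of_forall_notMem_eq_zero ?_
  swap; · intro w hw; exact absurd (mem_univ w) hw
  have hf0 : ∀ w, 0 ≤ f w := fun w ↦
    (hflow.heatKernelFn_pos hh hR ⟨hat₁, (ht₁t.trans htT).le⟩ w ⟨mem_univ _, has, hst₁⟩).le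
  set bB : ℝ := (2 * Real.exp Λ * (4 * Real.pi) ^ (-(m : ℝ) / 2) * Real.exp (-(m : ℝ) / 2) *
        Real.exp (2 * Real.sqrt ((m : ℝ) + Λ)) * ρ ^ (-(m : ℝ)) +
      2 * Real.sqrt (A * Hm) * Real.exp (c₁ + 3 * L₁ * (Real.sqrt (A * Hm) * ρ * Real.sqrt τ)) *
        Cgs * ρ * Z₂) * τ ^ (-(m : ℝ) / 2) * Real.exp (-(pointedNashEntropy h
          (fun r v ↦ hflow.heatKernelFn hh hR t x (v, r)) m t s)) with hbB
  have hbB0 : 0 ≤ bB := by positivity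
  have hballw : ∀ w ∈ Sᶜ, f w ≤ bB := by
    intro w hw
    have hw' : (h t₁).edist (hR t₁) z₁ w < ENNReal.ofReal r₀ := by
      simpa [hS] using hw
    exact hBall w hw'
  have hint_ball : ∫ w in Sᶜ, f w ∂ν ≤ bB := by
    have h1 : ∫ w in Sᶜ, f w ∂ν ≤ ∫ w in Sᶜ, bB ∂ν :=
      setIntegral_mono_on hfi.integrableOn (integrableOn_const) hSm.compl hballw
    have h2 : ∫ w in Sᶜ, bB ∂ν = ν.real Sᶜ * bB := by
      rw [setIntegral_const, smul_eq_mul]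
    have h3 : ν.real Sᶜ ≤ 1 := by
      rw [measureReal_def]
      exact ENNReal.toReal_mono ENNReal.one_ne_top prob_le_one
    calc ∫ w in Sᶜ, f w ∂ν ≤ ν.real Sᶜ * bB := h1.trans_eq h2
      _ ≤ 1 * bB := mul_le_mul_of_nonneg_right h3 hbB0
      _ = bB := one_mul _
  -- `u(x,t) ≤ (ball) + (tail)`
  have hsplit : hflow.heatKernelFn hh hR t x (y, s) ≤ bB +
      (1 - ρ ^ 2) ^ (-(m : ℝ) / 2) * Real.exp c₁ * Real.sqrt (3 / A) *
          Real.exp (16 * (L₁ * ρ * Real.sqrt τ) ^ 2 + Real.sqrt (2 * Hm) * (L₁ * ρ * Real.sqrt τ)) *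
        Z₁ * τ ^ (-(m : ℝ) / 2) * Real.exp (-(pointedNashEntropy h
          (fun r v ↦ hflow.heatKernelFn hh hR t x (v, r)) m t s)) := by
    rw [hrep, ← integral_add_compl hSm hfi, add_comm]
    exact add_le_add hint_ball hTail
  -- from here on only real arithmetic: forget the bodies of the abbreviations
  clear hBall hTail hint_ball hballw hrep hfi hfc hf0 hSm hdm hgrad hG' hEC' hEC₁ hvar₁ HZ₁ HZ₂
  clear_value bB f S r₀ ν Cgs c' L' c₁ V L₁ s₂ t₁ t Hm
  set Nx : ℝ := pointedNashEntropy h (fun r v ↦ hflow.heatKernelFn hh hR t x (v, r)) m t s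
    with hNx
  set P : ℝ := τ ^ ((m : ℝ) / 2) * Real.exp Nx with hP
  have hP0 : 0 ≤ P := by positivity
  have hPinv : P * (τ ^ (-(m : ℝ) / 2) * Real.exp (-Nx)) = 1 := by
    rw [hP, neg_div, Real.rpow_neg hτ.le, Real.exp_neg]
    field_simp
  -- scale-free bounds on the constants: `c₁ ≤ √(m+Λ) ρ √H`, `L₁ ρ √τ ≤ √(m+Λ) ρ`
  have hsqV : Real.sqrt V = Real.sqrt Hm * ρ * Real.sqrt τ := by
    rw [hV, htt₁, show Hm * (ρ ^ 2 * τ) = Hm * ρ ^ 2 * τ by ring,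
      Real.sqrt_mul (by positivity) τ, Real.sqrt_mul hHm0.le, Real.sqrt_sq hρ.le]
  have hc₁le : c₁ ≤ Real.sqrt ((m : ℝ) + Λ) * ρ * Real.sqrt Hm := by
    rw [hc₁, hsqV]
    calc L₁ * (Real.sqrt Hm * ρ * Real.sqrt τ) = (L₁ * Real.sqrt τ) * (ρ * Real.sqrt Hm) := by
          ring
      _ ≤ Real.sqrt ((m : ℝ) + Λ) * (ρ * Real.sqrt Hm) :=
          mul_le_mul_of_nonneg_right hL₁τ (by positivity)
      _ = _ := by ring
  have hq₁ : L₁ * ρ * Real.sqrt τ ≤ Real.sqrt ((m : ℝ) + Λ) * ρ := by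
    calc L₁ * ρ * Real.sqrt τ = (L₁ * Real.sqrt τ) * ρ := by ring
      _ ≤ Real.sqrt ((m : ℝ) + Λ) * ρ := mul_le_mul_of_nonneg_right hL₁τ hρ.le
  have hq₁0 : 0 ≤ L₁ * ρ * Real.sqrt τ := by positivity
  have hq₁sq : (L₁ * ρ * Real.sqrt τ) ^ 2 ≤ ((m : ℝ) + Λ) * ρ ^ 2 := by
    calc (L₁ * ρ * Real.sqrt τ) ^ 2 ≤ (Real.sqrt ((m : ℝ) + Λ) * ρ) ^ 2 :=
          pow_le_pow_left₀ hq₁0 hq₁ 2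
      _ = ((m : ℝ) + Λ) * ρ ^ 2 := by rw [mul_pow, Real.sq_sqrt hmΛ]
  have h3L : 3 * L₁ * (Real.sqrt (A * Hm) * ρ * Real.sqrt τ) ≤
      3 * Real.sqrt ((m : ℝ) + Λ) * Real.sqrt (A * Hm) * ρ := by
    calc 3 * L₁ * (Real.sqrt (A * Hm) * ρ * Real.sqrt τ)
        = 3 * (L₁ * Real.sqrt τ) * (Real.sqrt (A * Hm) * ρ) := by ring
      _ ≤ 3 * Real.sqrt ((m : ℝ) + Λ) * (Real.sqrt (A * Hm) * ρ) := by
          have := mul_le_mul_of_nonneg_right hL₁τ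
            (by positivity : (0 : ℝ) ≤ Real.sqrt (A * Hm) * ρ)
          linarith
      _ = _ := by ring
  have hE₂ : 2 * Real.sqrt (A * Hm) * Real.exp (c₁ + 3 * L₁ * (Real.sqrt (A * Hm) * ρ *
      Real.sqrt τ)) * Cgs * ρ ≤
      2 * Real.sqrt (A * Hm) * Real.exp ((Real.sqrt ((m : ℝ) + Λ) * Real.sqrt Hm +
        3 * Real.sqrt ((m : ℝ) + Λ) * Real.sqrt (A * Hm)) * ρ) * Cgs * ρ := by
    have hexp : Real.exp (c₁ + 3 * L₁ * (Real.sqrt (A * Hm) * ρ * Real.sqrt τ)) ≤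
        Real.exp ((Real.sqrt ((m : ℝ) + Λ) * Real.sqrt Hm +
          3 * Real.sqrt ((m : ℝ) + Λ) * Real.sqrt (A * Hm)) * ρ) := by
      refine Real.exp_le_exp.2 ?_
      have hsum := add_le_add hc₁le h3L
      have hrw : Real.sqrt ((m : ℝ) + Λ) * ρ * Real.sqrt Hm +
          3 * Real.sqrt ((m : ℝ) + Λ) * Real.sqrt (A * Hm) * ρ =
          (Real.sqrt ((m : ℝ) + Λ) * Real.sqrt Hm +
            3 * Real.sqrt ((m : ℝ) + Λ) * Real.sqrt (A * Hm)) * ρ := by ring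
      exact hsum.trans_eq hrw
    have h2 : 0 ≤ 2 * Real.sqrt (A * Hm) := by positivity
    exact mul_le_mul_of_nonneg_right (mul_le_mul_of_nonneg_right
      (mul_le_mul_of_nonneg_left hexp h2) hCgs0) hρ.le
  have hE₃ : (1 - ρ ^ 2) ^ (-(m : ℝ) / 2) * Real.exp c₁ * Real.sqrt (3 / A) *
      Real.exp (16 * (L₁ * ρ * Real.sqrt τ) ^ 2 + Real.sqrt (2 * Hm) * (L₁ * ρ * Real.sqrt τ)) ≤
      (1 - ρ ^ 2) ^ (-(m : ℝ) / 2) *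
        Real.exp (Real.sqrt ((m : ℝ) + Λ) * ρ * Real.sqrt Hm) * Real.sqrt (3 / A) *
        Real.exp (16 * (((m : ℝ) + Λ) * ρ ^ 2) +
          Real.sqrt (2 * Hm) * (Real.sqrt ((m : ℝ) + Λ) * ρ)) := by
    have he1 : Real.exp c₁ ≤ Real.exp (Real.sqrt ((m : ℝ) + Λ) * ρ * Real.sqrt Hm) :=
      Real.exp_le_exp.2 hc₁le
    have he2 : Real.exp (16 * (L₁ * ρ * Real.sqrt τ) ^ 2 +
        Real.sqrt (2 * Hm) * (L₁ * ρ * Real.sqrt τ)) ≤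
        Real.exp (16 * (((m : ℝ) + Λ) * ρ ^ 2) +
          Real.sqrt (2 * Hm) * (Real.sqrt ((m : ℝ) + Λ) * ρ)) := by
      refine Real.exp_le_exp.2 ?_
      have h1 := mul_le_mul_of_nonneg_left hq₁ (Real.sqrt_nonneg (2 * Hm))
      have h2 := mul_le_mul_of_nonneg_left hq₁sq (by norm_num : (0 : ℝ) ≤ 16)
      exact add_le_add h2 h1
    have ha : 0 ≤ (1 - ρ ^ 2) ^ (-(m : ℝ) / 2) := Real.rpow_nonneg h1ρ0.le _
    have hb : 0 ≤ Real.sqrt (3 / A) := Real.sqrt_nonneg _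
    refine mul_le_mul ?_ he2 (Real.exp_pos _).le (by positivity)
    exact mul_le_mul_of_nonneg_right (mul_le_mul_of_nonneg_left he1 ha) hb
  have hmain : P * hflow.heatKernelFn hh hR t x (y, s) ≤
      (2 * Real.exp Λ * (4 * Real.pi) ^ (-(m : ℝ) / 2) * Real.exp (-(m : ℝ) / 2) *
          Real.exp (2 * Real.sqrt ((m : ℝ) + Λ)) * ρ ^ (-(m : ℝ)) +
        2 * Real.sqrt (A * Hm) * Real.exp (c₁ + 3 * L₁ * (Real.sqrt (A * Hm) * ρ * Real.sqrt τ)) *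
          Cgs * ρ * Z₂) +
      (1 - ρ ^ 2) ^ (-(m : ℝ) / 2) * Real.exp c₁ * Real.sqrt (3 / A) *
          Real.exp (16 * (L₁ * ρ * Real.sqrt τ) ^ 2 + Real.sqrt (2 * Hm) * (L₁ * ρ * Real.sqrt τ)) *
        Z₁ := by
    have h1 := mul_le_mul_of_nonneg_left hsplit hP0
    refine h1.trans (le_of_eq ?_)
    rw [hbB]
    have e1 : ∀ E : ℝ, P * (E * τ ^ (-(m : ℝ) / 2) * Real.exp (-Nx)) = E := fun E ↦ by
      calc P * (E * τ ^ (-(m : ℝ) / 2) * Real.exp (-Nx))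
          = E * (P * (τ ^ (-(m : ℝ) / 2) * Real.exp (-Nx))) := by ring
        _ = E := by rw [hPinv, mul_one]
    rw [mul_add, e1, e1]
  calc τ ^ ((m : ℝ) / 2) * Real.exp Nx * hflow.heatKernelFn hh hR t x (y, s)
      = P * hflow.heatKernelFn hh hR t x (y, s) := by rw [hP]
    _ ≤ _ := hmain
    _ ≤ _ := add_le_add (add_le_add le_rfl (mul_le_mul_of_nonneg_right hE₂ hZ₂))
        (mul_le_mul_of_nonneg_right hE₃ hZ₁)

end Step

end Literature.Geometry.Riemannian

end
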